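import Mathlib
import Literature.NumberTheory.DiophantineGeometry.AbcWave0
import HarnessLib

/-!
# Primitive solutions of `x² + y³ = z⁷` (Poonen–Schaefer–Stoll 2007)

Topic `Literature/NumberTheory/DiophantineGeometry` (same shelf as `GeneralizedFermatSignatureNN2.lean`,
`GeneralizedFermatSignature55P.lean`, `AbcWave0.lean`).

Content: the main theorem of B. Poonen, E. F. Schaefer, M. Stoll, *Twists of `X(7)` and primitive solutions to
`x² + y³ = z⁷`*, Duke Math. J. **137** (2007) 103–158, doi:10.1215/S0012-7094-07-13714-1 [PoonenSchaeferStoll2007]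
— Theorem 1.1 of the journal version = Theorem 1 of the held text arXiv:math/0508174 (§1.1 «Main result», p. 1):

> «Fix integers `p, q, r ≥ 1`. An integer solution `(x, y, z)` to `x^p + y^q = z^r` is called *primitive* if
> `gcd(x, y, z) = 1`. […] **Theorem 1.** The primitive integer solutions to `x² + y³ = z⁷` are the 16 triples
> `(±1, −1, 0)`, `(±1, 0, 1)`, `±(0, 1, 1)`, `(±3, −2, 1)`, `(±71, −17, 2)`, `(±2213459, 1414, 65)`,
> `(±15312283, 9262, 113)`, `(±21063928, −76271, 17)`.»

The theorem is vendored AS PRINTED as the NAMED FACT `PoonenSchaeferStoll2007.primitiveSolutions237 : Prop` (a set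
equality: «primitive solution ⟺ one of the 16 listed triples»); its proof (descent to twists of the Klein quartic `X(7)`,
Chabauty and Mordell–Weil sieving on ten genus-`3` curves, with a large Magma computation) is far outside Mathlib and is
NOT reproduced. What IS proved here: the elementary half of the set equality (each listed triple is a primitive solution,
`mem_solutions_isPrimitiveSolution`, by evaluation), the bookkeeping about the list (`solutions_card`, the `z`-range
`le_113_of_mem_solutions`, the positive members `eq_of_mem_solutions_of_pos`), the comparison of the printed primitivity
`gcd(x, y, z) = 1` with the pairwise form `gcd(x, y) = 1` ON solutions (`isPrimitive_iff_gcd_eq_one`), and the corollaries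
wanted by the abc route workspace (`route-ABC-RootDecompE`, aside `SevenBoxBounded`): from the fact, every primitive
solution has `z ≤ 113`, the positive coprime solutions are `2213459² + 1414³ = 65⁷` and `15312283² + 9262³ = 113⁷`, and every
abc triple `(a, b, c) = (x², y³, z⁷)` (`IsABCTriple` of `AbcWave0.lean`) has `z ≤ 113` (`abcTriple_z_le_113`).

Adjacent to the abc / Fermat–Catalan circle of problems; NOT a claim on abc.
-/

namespace Literature.NumberTheory.DiophantineGeometry

namespace PoonenSchaeferStoll2007

/-- **Primitive** integer triple in the sense of [PSS07, §1.1, p. 1]: «An integer solution `(x, y, z)` to `x^p + y^q = z^r`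
is called primitive if `gcd(x, y, z) = 1`» — rendered with natural-number gcds of the absolute values (so that for
natural numbers it reads `Nat.gcd (Nat.gcd x y) z = 1`). [cite: PoonenSchaeferStoll2007, §1.1 p.1 (definition)] -/
def IsPrimitive (x y z : ℤ) : Prop :=
  Nat.gcd (Nat.gcd x.natAbs y.natAbs) z.natAbs = 1

/-- Unfolding of `IsPrimitive`. [cite: PoonenSchaeferStoll2007, §1.1 p.1 (definition)] -/
theorem isPrimitive_iff (x y z : ℤ) : IsPrimitive x y z ↔ Nat.gcd (Nat.gcd x.natAbs y.natAbs) z.natAbs = 1 :=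
  Iff.rfl

/-- A **primitive solution** of `x² + y³ = z⁷` [PSS07, §1.1]. [cite: PoonenSchaeferStoll2007, §1.1 p.1 (definition)] -/
def IsPrimitiveSolution (x y z : ℤ) : Prop :=
  x ^ 2 + y ^ 3 = z ^ 7 ∧ IsPrimitive x y z

/-- The sixteen triples of [PSS07, Thm. 1.1] (arXiv Thm. 1), listed with the signs expanded:
`(±1, −1, 0)`, `(±1, 0, 1)`, `±(0, 1, 1)`, `(±3, −2, 1)`, `(±71, −17, 2)`, `(±2213459, 1414, 65)`, `(±15312283, 9262, 113)`,
`(±21063928, −76271, 17)`. [cite: PoonenSchaeferStoll2007, Thm. 1.1] -/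
def solutions : Finset (ℤ × ℤ × ℤ) :=
  {(1, -1, 0), (-1, -1, 0), (1, 0, 1), (-1, 0, 1), (0, 1, 1), (0, -1, -1), (3, -2, 1), (-3, -2, 1),
    (71, -17, 2), (-71, -17, 2), (2213459, 1414, 65), (-2213459, 1414, 65), (15312283, 9262, 113),
    (-15312283, 9262, 113), (21063928, -76271, 17), (-21063928, -76271, 17)}

/-- **[PSS07, Theorem 1.1]** (journal numbering; = arXiv:math/0508174 Thm. 1), AS PRINTED: «The primitive integer solutions
to `x² + y³ = z⁷` are the 16 triples `(±1, −1, 0)`, `(±1, 0, 1)`, `±(0, 1, 1)`, `(±3, −2, 1)`, `(±71, −17, 2)`,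
`(±2213459, 1414, 65)`, `(±15312283, 9262, 113)`, `(±21063928, −76271, 17)`.» NAMED FACT (not proved here: descent to
twists of `X(7)`, Chabauty / Mordell–Weil sieve on ten genus-3 curves, Magma); the elementary inclusion «listed ⇒ primitive
solution» is `mem_solutions_isPrimitiveSolution` below, so the content of the hypothesis is the inclusion
`primitiveSolutions237_iff_subset`. [cite: PoonenSchaeferStoll2007, Thm. 1.1] -/
def primitiveSolutions237 : Prop :=
  ∀ x y z : ℤ, IsPrimitiveSolution x y z ↔ (x, y, z) ∈ solutions

/-! ### What is checked by evaluation about the printed list -/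

/-- The list of [PSS07, Thm. 1.1] has sixteen members. [cite: PoonenSchaeferStoll2007, Thm. 1.1] -/
theorem solutions_card : solutions.card = 16 := by
  decide

/-- The elementary half of [PSS07, Thm. 1.1]: every listed triple is a primitive solution of `x² + y³ = z⁷`
(e.g. `15312283² + 9262³ = 113⁷`, `gcd = 1`). [cite: PoonenSchaeferStoll2007, Thm. 1.1] -/
theorem mem_solutions_isPrimitiveSolution : ∀ t ∈ solutions, IsPrimitiveSolution t.1 t.2.1 t.2.2 := by
  unfold IsPrimitiveSolution IsPrimitive
  decide

/-- Every listed triple has `z ≤ 113` (the values of `z` are `0, 1, 2, 17, 65, 113`). [cite: PoonenSchaeferStoll2007, Thm. 1.1] -/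
theorem le_113_of_mem_solutions : ∀ t ∈ solutions, t.2.2 ≤ 113 := by
  decide

/-- `z = 113` is attained on the list (`(15312283, 9262, 113)`). [cite: PoonenSchaeferStoll2007, Thm. 1.1] -/
theorem mem_solutions_113 : ((15312283 : ℤ), (9262 : ℤ), (113 : ℤ)) ∈ solutions := by
  decide

/-- The listed triples with `x > 0` and `y > 0` are `(2213459, 1414, 65)` and `(15312283, 9262, 113)`.
[cite: PoonenSchaeferStoll2007, Thm. 1.1] -/
theorem eq_of_mem_solutions_of_pos :
    ∀ t ∈ solutions, 0 < t.1 → 0 < t.2.1 → t = (2213459, 1414, 65) ∨ t = (15312283, 9262, 113) := by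
  decide

/-- [PSS07, Thm. 1.1] is equivalent to the inclusion «primitive solution ⇒ listed» (the other inclusion is
`mem_solutions_isPrimitiveSolution`). [cite: PoonenSchaeferStoll2007, Thm. 1.1] -/
theorem primitiveSolutions237_iff_subset :
    primitiveSolutions237 ↔ ∀ x y z : ℤ, IsPrimitiveSolution x y z → (x, y, z) ∈ solutions := by
  refine ⟨fun h x y z hs => (h x y z).mp hs, fun h x y z => ⟨h x y z, fun hm => ?_⟩⟩
  exact mem_solutions_isPrimitiveSolution (x, y, z) hm

/-! ### Primitivity: `gcd(x, y, z) = 1` versus `gcd(x, y) = 1` on solutions -/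

/-- `gcd(x, y) = 1` implies `gcd(x, y, z) = 1` (unfolding of the printed definition of «primitive», [PSS07, §1.1]).
[cite: PoonenSchaeferStoll2007, §1.1 p.1 (definition, unfolded)] -/
theorem isPrimitive_of_gcd_eq_one {x y : ℤ} (z : ℤ) (h : Int.gcd x y = 1) : IsPrimitive x y z := by
  unfold IsPrimitive
  rw [show Nat.gcd x.natAbs y.natAbs = Int.gcd x y from rfl, h, Nat.gcd_one_left]

/-- `IsCoprime x y` implies `gcd(x, y, z) = 1` (unfolding of the printed definition of «primitive», [PSS07, §1.1]).
[cite: PoonenSchaeferStoll2007, §1.1 p.1 (definition, unfolded)] -/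
theorem isPrimitive_of_isCoprime {x y : ℤ} (z : ℤ) (h : IsCoprime x y) : IsPrimitive x y z :=
  isPrimitive_of_gcd_eq_one z (Int.isCoprime_iff_gcd_eq_one.mp h)

/-- On solutions of `x² + y³ = z⁷` the printed primitivity `gcd(x, y, z) = 1` is equivalent to `gcd(x, y) = 1`: a common
prime factor of `x` and `y` divides `z⁷`, hence `z` — [PSS07, §4.6, proof of the Lemma (arXiv Lemma 6 (a))]: «Since
`gcd(a, b, c) = 1` and `a² + b³ = c⁷`, the integers `a, b, c` are pairwise relatively prime.» (the `(a, b)` part).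
[cite: PoonenSchaeferStoll2007, §4.6 (proof of Lemma 6 (a), arXiv numbering)] -/
theorem isPrimitive_iff_gcd_eq_one {x y z : ℤ} (hxyz : x ^ 2 + y ^ 3 = z ^ 7) :
    IsPrimitive x y z ↔ Int.gcd x y = 1 := by
  refine ⟨fun h => ?_, fun h => isPrimitive_of_gcd_eq_one z h⟩
  unfold IsPrimitive at h
  rw [show Nat.gcd x.natAbs y.natAbs = Int.gcd x y from rfl] at h
  by_contra hne
  obtain ⟨p, hp, hpdvd⟩ := Nat.exists_prime_and_dvd hne
  have hpx : (p : ℤ) ∣ x := Int.natCast_dvd.mpr ((hpdvd.trans (Int.gcd_dvd_left x y |> Int.natCast_dvd.mp)))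
  have hpy : (p : ℤ) ∣ y := Int.natCast_dvd.mpr ((hpdvd.trans (Int.gcd_dvd_right x y |> Int.natCast_dvd.mp)))
  have hpz7 : (p : ℤ) ∣ z ^ 7 := by
    rw [← hxyz]
    exact dvd_add (dvd_pow hpx (by norm_num)) (dvd_pow hpy (by norm_num))
  have hpz : (p : ℤ) ∣ z := Int.Prime.dvd_pow' hp hpz7
  have hpz' : p ∣ z.natAbs := Int.natCast_dvd.mp hpz
  have : p ∣ Nat.gcd (Int.gcd x y) z.natAbs := Nat.dvd_gcd hpdvd hpz'
  rw [h] at this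
  exact hp.one_lt.ne' (Nat.dvd_one.mp this)

/-! ### Corollaries of the named fact (what the abc route workspace closes by citation) -/

/-- From [PSS07, Thm. 1.1]: every primitive solution of `x² + y³ = z⁷` has `z ≤ 113`.
[cite: PoonenSchaeferStoll2007, Thm. 1.1 (corollary)] -/
theorem z_le_113 (h : primitiveSolutions237) {x y z : ℤ} (hxyz : x ^ 2 + y ^ 3 = z ^ 7)
    (hprim : IsPrimitive x y z) : z ≤ 113 :=
  le_113_of_mem_solutions (x, y, z) ((h x y z).mp ⟨hxyz, hprim⟩)

/-- From [PSS07, Thm. 1.1], in the shape suggested by the requesting route (`IsCoprime x y`): every solution of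
`x² + y³ = z⁷` with `x, y` coprime is one of the sixteen listed triples. [cite: PoonenSchaeferStoll2007, Thm. 1.1 (corollary)] -/
theorem mem_solutions_of_isCoprime (h : primitiveSolutions237) {x y z : ℤ} (hxy : IsCoprime x y)
    (hxyz : x ^ 2 + y ^ 3 = z ^ 7) : (x, y, z) ∈ solutions :=
  (h x y z).mp ⟨hxyz, isPrimitive_of_isCoprime z hxy⟩

/-- From [PSS07, Thm. 1.1]: the solutions of `x² + y³ = z⁷` in positive coprime natural numbers `x, y` are
`2213459² + 1414³ = 65⁷` and `15312283² + 9262³ = 113⁷`. [cite: PoonenSchaeferStoll2007, Thm. 1.1 (corollary)] -/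
theorem eq_of_pos_of_coprime (h : primitiveSolutions237) {x y z : ℕ} (hx : 0 < x) (hy : 0 < y)
    (hxy : Nat.Coprime x y) (hxyz : x ^ 2 + y ^ 3 = z ^ 7) :
    (x, y, z) = (2213459, 1414, 65) ∨ (x, y, z) = (15312283, 9262, 113) := by
  have hmem : ((x : ℤ), (y : ℤ), (z : ℤ)) ∈ solutions := by
    refine (h x y z).mp ⟨by exact_mod_cast hxyz, ?_⟩
    refine isPrimitive_of_gcd_eq_one _ ?_
    rw [Int.gcd_natCast_natCast]
    exact hxy
  rcases eq_of_mem_solutions_of_pos _ hmem (show (0 : ℤ) < (x : ℤ) by exact_mod_cast hx)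
      (show (0 : ℤ) < (y : ℤ) by exact_mod_cast hy) with hcase | hcase
  · left
    simp only [Prod.mk.injEq] at hcase ⊢
    exact ⟨by exact_mod_cast hcase.1, by exact_mod_cast hcase.2.1, by exact_mod_cast hcase.2.2⟩
  · right
    simp only [Prod.mk.injEq] at hcase ⊢
    exact ⟨by exact_mod_cast hcase.1, by exact_mod_cast hcase.2.1, by exact_mod_cast hcase.2.2⟩

/-- From [PSS07, Thm. 1.1]: every abc triple of the shape `(a, b, c) = (x², y³, z⁷)` (`IsABCTriple`: `a, b ≥ 1` coprime,
`a + b = c`) has `z ≤ 113` — the statement `SevenBoxBounded` of the abc route workspace `route-ABC-RootDecompE`, closed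
BY CITATION modulo the named fact. (`113` is attained: `15312283² + 9262³ = 113⁷`, `mem_solutions_113`.)
[cite: PoonenSchaeferStoll2007, Thm. 1.1 (corollary)] -/
theorem abcTriple_z_le_113 (h : primitiveSolutions237) :
    ∀ a b c x y z : ℕ, IsABCTriple a b c → a = x ^ 2 → b = y ^ 3 → c = z ^ 7 → z ≤ 113 := by
  rintro a b c x y z ⟨-, -, habc, hcop⟩ rfl rfl rfl
  have hxy : Nat.Coprime x y :=
    (Nat.coprime_pow_right_iff (by norm_num) _ _).mp ((Nat.coprime_pow_left_iff (by norm_num) _ _).mp hcop)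
  have hz : (z : ℤ) ≤ 113 := by
    refine z_le_113 h (x := x) (y := y) (by exact_mod_cast habc) ?_
    refine isPrimitive_of_gcd_eq_one _ ?_
    rw [Int.gcd_natCast_natCast]
    exact hxy
  exact_mod_cast hz

end PoonenSchaeferStoll2007

end Literature.NumberTheory.DiophantineGeometry
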